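import Mathlib

/-!
# wall_bubbling — obligation (M) `Stmt.stub_mixedWalls`: FACET INTERIORS, CELLS and DEEPER STRATA — STATEMENT FILE (P1″ (i), typed coverage plan)

Crux `DoorA26` (stmt-ValiantsHypothesis-19979, `= PosRootLawAt 2 6 19`, OPEN, never asserted here), line `Cruxes/DoorA26/Lines/wall_bubbling.lean`
@04ebf105c7df, obligation **(M)** `Stmt.stub_mixedWalls : ∀ δ ∈ SortedSimplex, δ ∈ closure TwentyLocus → ¬ HasMixedCoincidence δ`.  Line lead val-idea-15 g3
(planner); critic of record for the (M) instrument val-idea-crit-5 g2 (VERDICT #2, price P1″: "the statement (M-cert)+(M-strata) as typed Props; which cells next and at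
what cost; what a facet-UNIFORM certificate would look like").  UNREGISTERED (never `ledger skeleton check`); nothing here is a route item, a stub, or a claim about the crux;
0 `sorry`; the theorems are pure-logic splits.

## The split, in words

A point `δ` of the sorted simplex with a mixed coincidence `2δᵢ = δ_k + δ_l` lies either
* in the RELATIVE INTERIOR OF A MIXED FACET (`IsMixedFacetInterior δ i k l`: that coincidence is the ONLY coincidence among the 21 pair sums — removing the pair `(i,i)`
  the remaining 20 pair sums are pairwise distinct), or
* on a DEEPER STRATUM (a second coincidence of any kind: another mixed or disjoint relation, or a Weyl coincidence `δ_a = δ_b`).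
`Stmt.mixedWalls_facets` / `Stmt.mixedWalls_strata` are (M) restricted to the two cases; `mixedWalls_of_facets_of_strata` is the split.  A facet interior is the disjoint
union of its CELLS = order types of the 20 distinct pair sums (W1 door-p2 g11 FACETS.json: 4 640 mixed facets of the (2,6) chamber complex, 2 320 modulo the mirror
`δ ↦ 1 − δ∘rev`; each facet has two SIDES = adjacent chambers); `Stmt.mixedWalls_cell i k l r` is (M) on the cell whose pair-sum order is the ranking `r`, and
`mixedWalls_facets_of_cells` reduces the facet statement to the finite list of cell statements (rankings that are not realised give vacuous cells).

## Coverage ledger (numbers of record, W1 (M) CELL LEDGER rev 2, bus `pub-symmetroid/INBOX.md` 2026-08-28T16:47:44Z; landed chamber rows rg 16:23Z = 1 288)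

Of the 4 640 mixed facets: **1 192 STAR-FREE** (both adjacent chamber rows LANDED ⇒ the facet's generic points are not limits of twenties, kernel:
`not_mem_closure_twentyLocus_of_adjacent_rows`, W1 `…WallBubblingConeTransfer`/`…StarRows`; note `TwentyLocus` itself is disjoint from every wall — 20 distinct
exponents admit ≤ 19 positive roots — so accumulation at a facet point comes only from its two open sides); **932 cleared modulo the PARITY column** (each side landed or
parity-KILL(j) `mixedWall_parity_kill` p644771 — heuristic grade at a facet until the sign-keeping KILL(j) #10 lands); **2 226 ONE SIDE OPEN; 290 BOTH SIDES OPEN**; the HARD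
CORE (facets of the residual chambers 1/954/1706/1709): 18 facets, 10 one-side-open, 8 both-open.  The per-point second-order sieve (memo `wall_bubbling_M-sieve.md`: 85/98 runs
0 survivors at 49 rational wall points; certificates independently re-derived except LEAF-row provenance) certifies single rational points of cells; **no cell is certified
uniformly** — `Stmt.mixedWalls_cell` is OPEN for every one of the 2 516 open-side facets' cells, and this is the mathematical frontier of (M) (memo §2.7, §5 P1″).

HONEST FRAMING.  Bookkeeping only: (M), (W), (R), `DoorA26`, `MatrixDescartes` 18050 OPEN; VP ≠ VNP not moved.
-/

namespace Summit.ValiantsHypothesis.ValiantsHypothesis.Cruxes.DoorA26.WallBubbling.MixedCells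

open scoped BigOperators

noncomputable section

/-- verbatim copy (line file `wall_bubbling.lean`): exponent vectors at which some symmetric (2,6) pencil has ≥ 20 positive determinant roots. -/
def TwentyLocus : Set (Fin 6 → ℝ) :=
  {δ | ∃ S : Fin 6 → Matrix (Fin 2) (Fin 2) ℝ, (∀ l, (S l).IsSymm) ∧
    20 ≤ {x : ℝ | 0 < x ∧ (∑ l, (x ^ (δ l)) • S l).det = 0}.ncard}

/-- verbatim copy (line file): the sorted exponent simplex. -/
def SortedSimplex : Set (Fin 6 → ℝ) := {δ | Monotone δ ∧ δ 0 = 0 ∧ δ (Fin.last 5) = 1}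

/-- verbatim copy (line file): a MIXED coincidence `2δᵢ = δ_k + δ_l` among three distinct letters. -/
def HasMixedCoincidence (δ : Fin 6 → ℝ) : Prop :=
  ∃ i k l : Fin 6, i ≠ k ∧ i ≠ l ∧ k ≠ l ∧ 2 * δ i = δ k + δ l

/-- verbatim copy of the line's obligation (M). -/
def Stmt.stub_mixedWalls : Prop :=
  ∀ δ ∈ SortedSimplex, δ ∈ closure TwentyLocus → ¬ HasMixedCoincidence δ

/-- the pair-sum map on index pairs. -/
def pairSum (δ : Fin 6 → ℝ) (p : Fin 6 × Fin 6) : ℝ := δ p.1 + δ p.2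

/-- the 21 unordered index pairs, as the pairs `(a,b)` with `a ≤ b`. -/
def UPairs : Set (Fin 6 × Fin 6) := {p | p.1 ≤ p.2}

/-- `δ` lies in the RELATIVE INTERIOR of the mixed facet `2δᵢ = δ_k + δ_l` (`k < l`, `i ∉ {k,l}`): that is the only coincidence of pair sums — with the pair `(i,i)`
removed, the remaining 20 pair sums (including `δ_k + δ_l`) are pairwise distinct. -/
def IsMixedFacetInterior (δ : Fin 6 → ℝ) (i k l : Fin 6) : Prop :=
  i ≠ k ∧ i ≠ l ∧ k < l ∧ 2 * δ i = δ k + δ l ∧ Set.InjOn (pairSum δ) (UPairs \ {(i, i)})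

/-- (M-cert) — (M) on the relative interiors of the mixed facets. OPEN (certified only at single rational points, memo §3). -/
def Stmt.mixedWalls_facets : Prop :=
  ∀ δ ∈ SortedSimplex, ∀ i k l : Fin 6, IsMixedFacetInterior δ i k l → δ ∉ closure TwentyLocus

/-- (M-strata) — (M) at mixed points on deeper strata (a second coincidence of any kind). OPEN. -/
def Stmt.mixedWalls_strata : Prop :=
  ∀ δ ∈ SortedSimplex, HasMixedCoincidence δ → (∀ i k l : Fin 6, ¬ IsMixedFacetInterior δ i k l) → δ ∉ closure TwentyLocus

/-- The split (M) ⟸ (M-cert) ∧ (M-strata) — pure logic. -/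
theorem mixedWalls_of_facets_of_strata (hf : Stmt.mixedWalls_facets) (hs : Stmt.mixedWalls_strata) : Stmt.stub_mixedWalls := by
  intro δ hδ hcl hM
  by_cases h : ∃ i k l : Fin 6, IsMixedFacetInterior δ i k l
  · obtain ⟨i, k, l, hikl⟩ := h
    exact hf δ hδ i k l hikl hcl
  · simp only [not_exists] at h
    exact hs δ hδ hM h hcl

/-- `δ` lies in the CELL of the facet `2δᵢ = δ_k + δ_l` whose pair-sum order is the ranking `r` (`r` strictly order-preserving on pair sums of distinct value; rankings
that no `δ` realises give an empty cell).  The cells are the order types of the 20 distinct pair sums = the (facet, side-pair) records of FACETS.json. -/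
def InMixedCell (δ : Fin 6 → ℝ) (i k l : Fin 6) (r : Fin 6 × Fin 6 → ℕ) : Prop :=
  IsMixedFacetInterior δ i k l ∧ ∀ p ∈ UPairs, ∀ q ∈ UPairs, pairSum δ p < pairSum δ q → r p < r q

/-- (M) on ONE CELL — the unit a facet-uniform certificate would close.  OPEN for every cell with an open side (2 226 + 290 facets); closed in kernel, at generic points,
for the 1 192 star-free facets by `not_mem_closure_twentyLocus_of_adjacent_rows`. -/
def Stmt.mixedWalls_cell (i k l : Fin 6) (r : Fin 6 × Fin 6 → ℕ) : Prop :=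
  ∀ δ ∈ SortedSimplex, InMixedCell δ i k l r → δ ∉ closure TwentyLocus

/-- the canonical ranking of a point: the number of unordered pairs with strictly smaller pair sum. -/
def rankOf (δ : Fin 6 → ℝ) (p : Fin 6 × Fin 6) : ℕ :=
  ((Finset.univ : Finset (Fin 6 × Fin 6)).filter (fun q => q.1 ≤ q.2 ∧ pairSum δ q < pairSum δ p)).card

theorem rankOf_lt_of_lt (δ : Fin 6 → ℝ) {p q : Fin 6 × Fin 6} (hp : p ∈ UPairs) (h : pairSum δ p < pairSum δ q) :
    rankOf δ p < rankOf δ q := by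
  unfold rankOf
  apply Finset.card_lt_card
  rw [Finset.ssubset_iff_of_subset]
  · refine ⟨p, ?_, ?_⟩
    · simp only [Finset.mem_filter, Finset.mem_univ, true_and]
      exact ⟨hp, h⟩
    · simp only [Finset.mem_filter, Finset.mem_univ, true_and, not_and, not_lt]
      intro _
      exact le_refl _
  · intro x hx
    simp only [Finset.mem_filter, Finset.mem_univ, true_and] at hx ⊢
    exact ⟨hx.1, hx.2.trans h⟩

/-- The facet statement is the conjunction of its (finitely many) cell statements — pure logic via the canonical ranking. -/
theorem mixedWalls_facets_of_cells (h : ∀ i k l : Fin 6, ∀ r : Fin 6 × Fin 6 → ℕ, Stmt.mixedWalls_cell i k l r) : Stmt.mixedWalls_facets := by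
  intro δ hδ i k l hikl
  exact h i k l (rankOf δ) δ hδ ⟨hikl, fun p hp q _ hpq => rankOf_lt_of_lt δ hp hpq⟩

end

end Summit.ValiantsHypothesis.ValiantsHypothesis.Cruxes.DoorA26.WallBubbling.MixedCells
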